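import Summits.CriticalPhenomena.PercolationContinuityZ3.Theorems.PercNearOneGluingNoHeavyQuantFarSunHairCert
import HarnessLib

/-!
# FAR beyond trees: the UNIVERSAL-WITNESS hair-only certificate for `SunFAR K j`

builds on p205010 (kernel theorem, internal audit signed; external expert review pending)

Support file (`--supports stmt-CriticalPhenomena-4575`), seat `prim-cert-1` (gen 34); memo `prim-cert-1/FROM-prim-cert-1-g34-UNIVERSAL-WITNESS.md`.

A hair-only certificate in the sense of `HairyCycle.sunFAR_of_hairCert` (p367779) that is valid BY PURE COMBINATORICS whenever its
"witness mass" is at least one.  For an open-hair pattern `Q ⊆ range K` the **witness set** `wit j Q` consists of the members `d ∈ Q` with at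
least `j` members of `Q` strictly below `d` and at least `j` strictly above (`HairyCycle.wit`; nonempty iff `#Q ≥ 2j+1`).  A witness lies in a
coverage set `C = cov K l l'` (a prefix-plus-suffix of the positions) only if `#(Q ∩ C) ≥ j+1` (`HairyCycle.card_inter_cov_of_mem_wit`): `C ∋ d`
contains every position below `d` or every position above `d`.  Fix any selection `z Q ∈ wit j Q` (e.g. the least reliable witness) and put
`p_k = P(z(Q) = k, wit ≠ ∅)` (`HairyCycle.witMass`), `G = Σ_k p_k / h_k` (`HairyCycle.witG`, `= E[1/h_{z}; #Q ≥ 2j+1]`).  Then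
`λ_k = p_k/(h_k G)`, `μ = 0` satisfies `Σ λ = 1` and, on every coverage set, `Σ_{k∈C} λ_k h_k = P(z ∈ C)/G ≤ hairV(C)/G ≤ hairV(C)` as soon as `G ≥ 1`
(**`HairyCycle.hairCert_of_witness`**).  Probabilistic reading: for EVERY joint law of the two arms, `P(N ≥ j+1) ≥ P(z ∈ C) ≥ x·G ≥ x`
(`x` = least marginal) — no `E N > 2j` hypothesis is used; the rule is one half of the two-rule menu {universal witness, weakest-hair bet}
studied numerically in the memo (complete for `K ≥ 4j+1` in all tests).  No sorries; standard axioms.  Elementary [this work].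
[cite: KozmaNitzan2024, Conjecture 3 (p. 15)] (context: the lower-tail family FAR serves).
-/

noncomputable section

namespace Summit.CriticalPhenomena.PercolationContinuityZ3.Theorems.HairyCycle

open Finset
open scoped Classical

variable {K : ℕ}

/-! ## Witnesses of an open-hair pattern -/

/-- **Witness set** of an open-hair pattern `Q` at layer `j`: the members `d ∈ Q` with at least `j` members of `Q` strictly below `d`
and at least `j` members strictly above `d`. [this work] -/
def wit (j : ℕ) (Q : Finset ℕ) : Finset ℕ :=
  Q.filter fun d => j ≤ (Q.filter fun e => e < d).card ∧ j ≤ (Q.filter fun e => d < e).card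

/-- A witness is a member of the pattern. [this work] -/
theorem mem_of_mem_wit {j : ℕ} {Q : Finset ℕ} {d : ℕ} (hd : d ∈ wit j Q) : d ∈ Q :=
  (Finset.mem_filter.1 hd).1

/-- **The witness property**: if a witness `d` of `Q` lies in the coverage set `cov K l l'`, then at least `j+1` members of `Q` do
(`Q ⊆ range K`). [this work] -/
theorem card_inter_cov_of_mem_wit {j : ℕ} {Q : Finset ℕ} (hQ : Q ⊆ range K) {d : ℕ} (hd : d ∈ wit j Q) {l l' : ℕ}
    (hdC : d ∈ cov K l l') : j + 1 ≤ (Q ∩ cov K l l').card := by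
  obtain ⟨hdQ, hbelow, habove⟩ := Finset.mem_filter.1 hd
  rw [mem_cov] at hdC
  rcases hdC.2 with hdl | hdl'
  · -- every member of `Q` below `d` is covered (clockwise), and so is `d`
    have hsub : insert d (Q.filter fun e => e < d) ⊆ Q ∩ cov K l l' := by
      intro e he
      rw [Finset.mem_insert] at he
      rw [Finset.mem_inter, mem_cov]
      rcases he with rfl | he
      · exact ⟨hdQ, hdC.1, Or.inl hdl⟩
      · obtain ⟨heQ, hed⟩ := Finset.mem_filter.1 he
        exact ⟨heQ, Finset.mem_range.1 (hQ heQ), Or.inl (lt_trans hed hdl)⟩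
    have hcard : (insert d (Q.filter fun e => e < d)).card = (Q.filter fun e => e < d).card + 1 :=
      Finset.card_insert_of_notMem (by simp)
    have := Finset.card_le_card hsub
    omega
  · -- every member of `Q` above `d` is covered (counter-clockwise), and so is `d`
    have hsub : insert d (Q.filter fun e => d < e) ⊆ Q ∩ cov K l l' := by
      intro e he
      rw [Finset.mem_insert] at he
      rw [Finset.mem_inter, mem_cov]
      rcases he with rfl | he
      · exact ⟨hdQ, hdC.1, Or.inr hdl'⟩
      · obtain ⟨heQ, hde⟩ := Finset.mem_filter.1 he
        exact ⟨heQ, Finset.mem_range.1 (hQ heQ), Or.inr (le_trans hdl' (le_of_lt hde))⟩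
    have hcard : (insert d (Q.filter fun e => d < e)).card = (Q.filter fun e => d < e).card + 1 :=
      Finset.card_insert_of_notMem (by simp)
    have := Finset.card_le_card hsub
    omega

/-! ## Witness mass of a selection -/

/-- **Witness mass at position `k`** for a selection `z`: `p_k = Σ_{Q ⊆ range K, wit j Q ≠ ∅, z Q = k} hairW K h Q`
(the probability that the selected witness is `k`). [this work] -/
def witMass (K : ℕ) (h : ℕ → ℝ) (j : ℕ) (z : Finset ℕ → ℕ) (k : ℕ) : ℝ :=
  ∑ Q ∈ (range K).powerset, if (wit j Q).Nonempty ∧ z Q = k then hairW K h Q else 0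

/-- **Total witness weight** `G = Σ_{k<K} p_k / h_k` (`= E[1/h_z ; #Q ≥ 2j+1]`). [this work] -/
def witG (K : ℕ) (h : ℕ → ℝ) (j : ℕ) (z : Finset ℕ → ℕ) : ℝ :=
  ∑ k ∈ range K, witMass K h j z k / h k

/-- The witness mass is nonnegative (`h ∈ [0,1]`). [this work] -/
theorem witMass_nonneg {h : ℕ → ℝ} (hh : ∀ k, k < K → 0 ≤ h k ∧ h k ≤ 1) (j : ℕ) (z : Finset ℕ → ℕ) (k : ℕ) :
    0 ≤ witMass K h j z k :=
  Finset.sum_nonneg fun Q _ => by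
    split_ifs
    · exact hairW_nonneg hh Q
    · exact le_rfl

/-- A pattern containing a dead hair (`h k = 0`, `k ∈ Q`) has weight zero. [this work] -/
theorem hairW_eq_zero_of_mem {h : ℕ → ℝ} {Q : Finset ℕ} {k : ℕ} (hk : k < K) (hkQ : k ∈ Q) (h0 : h k = 0) :
    hairW K h Q = 0 := by
  unfold hairW
  exact Finset.prod_eq_zero (Finset.mem_range.2 hk) (by rw [if_pos hkQ, h0])

/-- If the selection always picks a witness, the mass at a dead position vanishes. [this work] -/
theorem witMass_eq_zero_of_h_eq_zero {h : ℕ → ℝ} {j : ℕ} {z : Finset ℕ → ℕ}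
    (hz : ∀ Q, Q ⊆ range K → (wit j Q).Nonempty → z Q ∈ wit j Q) {k : ℕ} (h0 : h k = 0) :
    witMass K h j z k = 0 := by
  refine Finset.sum_eq_zero fun Q hQ => ?_
  rw [Finset.mem_powerset] at hQ
  split_ifs with hc
  · have hkQ : k ∈ Q := by rw [← hc.2]; exact mem_of_mem_wit (hz Q hQ hc.1)
    exact hairW_eq_zero_of_mem (Finset.mem_range.1 (hQ hkQ)) hkQ h0
  · rfl

/-- `(p_k / h_k) · h_k = p_k` (also when `h k = 0`, both sides being `0`). [this work] -/
theorem witMass_div_mul {h : ℕ → ℝ} {j : ℕ} {z : Finset ℕ → ℕ}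
    (hz : ∀ Q, Q ⊆ range K → (wit j Q).Nonempty → z Q ∈ wit j Q) (k : ℕ) :
    witMass K h j z k / h k * h k = witMass K h j z k := by
  by_cases h0 : h k = 0
  · rw [witMass_eq_zero_of_h_eq_zero hz h0, zero_div, zero_mul]
  · exact div_mul_cancel₀ _ h0

/-- **Witness mass on a coverage set ≤ its hair-only value**: `Σ_{k ∈ C} p_k ≤ hairV K h j C` for `C = cov K l l'`. [this work] -/
theorem sum_witMass_cov_le_hairV {h : ℕ → ℝ} (hh : ∀ k, k < K → 0 ≤ h k ∧ h k ≤ 1) {j : ℕ} {z : Finset ℕ → ℕ}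
    (hz : ∀ Q, Q ⊆ range K → (wit j Q).Nonempty → z Q ∈ wit j Q) (l l' : ℕ) :
    ∑ k ∈ cov K l l', witMass K h j z k ≤ hairV K h j (cov K l l') := by
  unfold witMass hairV
  rw [Finset.sum_comm]
  refine Finset.sum_le_sum fun Q hQ => ?_
  rw [Finset.mem_powerset] at hQ
  -- for a fixed pattern at most one position carries its weight
  have h1 : ∑ k ∈ cov K l l', (if (wit j Q).Nonempty ∧ z Q = k then hairW K h Q else 0) =
      if (wit j Q).Nonempty ∧ z Q ∈ cov K l l' then hairW K h Q else 0 := by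
    by_cases hne : (wit j Q).Nonempty
    · simp only [hne, true_and]
      rw [Finset.sum_ite_eq]
    · simp only [hne, false_and, if_false, Finset.sum_const_zero]
  rw [h1]
  by_cases hc : (wit j Q).Nonempty ∧ z Q ∈ cov K l l'
  · rw [if_pos hc, if_pos (card_inter_cov_of_mem_wit hQ (hz Q hQ hc.1) hc.2), mul_one]
  · rw [if_neg hc]
    exact mul_nonneg (hairW_nonneg hh Q) (by split_ifs <;> norm_num)

/-! ## The certificate -/

/-- **THE UNIVERSAL-WITNESS CERTIFICATE.**  For `h ∈ [0,1]` and any selection `z` of witnesses with total witness weight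
`G = Σ_k p_k/h_k ≥ 1`, the weights `λ_k = p_k/(h_k G)` with deficit multiplier `μ = 0` form a hair-only certificate:
`λ ≥ 0`, `Σ_{k<K} λ_k = 1`, and `Σ_{k∈C} λ_k h_k + 0·(…) ≤ hairV K h j C` on every coverage set `C = cov K l l'`, `(l,l') ∈ arcIx K`
(indeed for all `l, l'`).  This is exactly the hypothesis shape of `HairyCycle.sunFAR_of_hairCert`. [this work] -/
theorem hairCert_of_witness {h : ℕ → ℝ} (hh : ∀ k, k < K → 0 ≤ h k ∧ h k ≤ 1) {j : ℕ} (z : Finset ℕ → ℕ)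
    (hz : ∀ Q, Q ⊆ range K → (wit j Q).Nonempty → z Q ∈ wit j Q) (hG : 1 ≤ witG K h j z) :
    ∃ lam : ℕ → ℝ, ∃ μ : ℝ, (∀ k, 0 ≤ lam k) ∧ ∑ k ∈ range K, lam k = 1 ∧ 0 ≤ μ ∧
      ∀ p ∈ arcIx K, ∑ k ∈ cov K p.1 p.2, lam k * h k + μ * (∑ k ∈ cov K p.1 p.2, h k - 2 * j) ≤
        hairV K h j (cov K p.1 p.2) := by
  have hGpos : 0 < witG K h j z := lt_of_lt_of_le one_pos hG
  refine ⟨fun k => witMass K h j z k / h k / witG K h j z, 0, fun k => ?_, ?_, le_rfl, fun p _ => ?_⟩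
  · -- nonnegativity
    refine div_nonneg (?_) hGpos.le
    by_cases h0 : h k = 0
    · rw [h0, div_zero]
    · by_cases hk : k < K
      · exact div_nonneg (witMass_nonneg hh j z k) (hh k hk).1
      · -- positions `k ≥ K` carry no mass
        have : witMass K h j z k = 0 := by
          refine Finset.sum_eq_zero fun Q hQ => ?_
          rw [Finset.mem_powerset] at hQ
          split_ifs with hc
          · exact absurd (Finset.mem_range.1 (hQ (by rw [← hc.2]; exact mem_of_mem_wit (hz Q hQ hc.1)))) hk
          · rfl
        rw [this, zero_div]
  · -- normalisation
    rw [← Finset.sum_div, div_eq_one_iff_eq hGpos.ne']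
    rfl
  · -- the rows
    rw [zero_mul, add_zero]
    have h1 : ∑ k ∈ cov K p.1 p.2, witMass K h j z k / h k / witG K h j z * h k =
        (∑ k ∈ cov K p.1 p.2, witMass K h j z k) / witG K h j z := by
      rw [Finset.sum_div]
      refine Finset.sum_congr rfl fun k _ => ?_
      rw [div_mul_eq_mul_div, witMass_div_mul hz]
    rw [h1]
    have hV : 0 ≤ hairV K h j (cov K p.1 p.2) :=
      Finset.sum_nonneg fun Q _ => mul_nonneg (hairW_nonneg hh Q) (by split_ifs <;> norm_num)
    calc (∑ k ∈ cov K p.1 p.2, witMass K h j z k) / witG K h j z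
        ≤ hairV K h j (cov K p.1 p.2) / witG K h j z :=
          div_le_div_of_nonneg_right (sum_witMass_cov_le_hairV hh hz p.1 p.2) hGpos.le
      _ ≤ hairV K h j (cov K p.1 p.2) := div_le_self hV hG

/-- **Reduction of `SunFAR K j` to the low-witness-weight regime.**  Fix, for every hair-weight vector `h`, a selection of witnesses
`z h`.  If a hair-only certificate is supplied for every `g, h ∈ [0,1]` with `2j < EN` AND total witness weight `G < 1`, then
`SunFAR K j` (`K ≥ 2`): in the complementary regime `G ≥ 1` the universal-witness certificate `HairyCycle.hairCert_of_witness` serves.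
(This is the form in which the all-`K` programme uses the rule: only the regime `G < 1` needs an `h`-specific argument.) [this work] -/
theorem sunFAR_of_hairCert_lowWitness (hK : 2 ≤ K) {j : ℕ} (z : (ℕ → ℝ) → Finset ℕ → ℕ)
    (hz : ∀ h : ℕ → ℝ, ∀ Q, Q ⊆ range K → (wit j Q).Nonempty → z h Q ∈ wit j Q)
    (hc : ∀ g h : ℕ → ℝ, (∀ m, m ≤ K → 0 ≤ g m ∧ g m ≤ 1) → (∀ k, k < K → 0 ≤ h k ∧ h k ≤ 1) →
      (2 * j : ℝ) < ∑ k ∈ range K, sunMarg K g h k → witG K h j (z h) < 1 →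
      ∃ lam : ℕ → ℝ, ∃ μ : ℝ, (∀ k, 0 ≤ lam k) ∧ ∑ k ∈ range K, lam k = 1 ∧ 0 ≤ μ ∧
        ∀ p ∈ arcIx K, ∑ k ∈ cov K p.1 p.2, lam k * h k + μ * (∑ k ∈ cov K p.1 p.2, h k - 2 * j) ≤
          hairV K h j (cov K p.1 p.2)) :
    SunFAR K j := by
  refine sunFAR_of_hairCert hK fun g h hg hh hEN => ?_
  by_cases hG : 1 ≤ witG K h j (z h)
  · exact hairCert_of_witness hh (z h) (hz h) hG
  · exact hc g h hg hh hEN (lt_of_not_ge hG)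

end Summit.CriticalPhenomena.PercolationContinuityZ3.Theorems.HairyCycle

end
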